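import Summits.Langlands.Langlands.Theorems.QuadraticWindowHostInducedRepAsaiLocalInduced
import Summits.Langlands.Langlands.Theorems.QuadraticWindowHostInducedRepAsaiTowerPlaces
import Summits.Langlands.Langlands.Theorems.HostInducedRep.Negative.AsaiSignHazard

/-!
# The local Asai identity in a biquadratic tower, Ia: fibres of a quadratic subextension —
helper file 3 for stub `stub_asaiPoleInduced` of line `one-transparent-pane`
(crux `Summit.Langlands.Langlands.Theses.QuadraticWindow.HostInducedRep`, item stmt-Langlands-10902)

LOG (worker `stub_asaiPoleInduced`).  FACT-FREE.  Setting: `F₀ ⊆ K ⊆ L` with `[L:K] = 2`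
(involution `t`), `[L:F₀] = 4`, and a second quadratic subextension `F₀ ⊆ E' ⊆ L`, `[L:E'] = 2`, with
involution `θ` such that `θ₀ = θ|^{F₀}` and `t₀ = t|^{F₀}` generate the Klein group `Gal(L/F₀)`
(`AsaiTowerPlaces`).  Proved here:

* (the induced Satake polynomial at a place of a middle field `M` with `[L:M] = 2` — `P_{A' w₀} P_{A' (t w₀)}`
  (split) or `P_{A' w₀}(X²)` (inert, unramified), Arthur–Clozel (6.1)–(6.2) — is read off the landed
  `induced_split` / `induced_inert` of the sibling helper file `…MemberSatakeData`, and
  `(w ∩ 𝓞 M) ∩ 𝓞 F₀ = w ∩ 𝓞 F₀` is the landed `under_under_place` of `…MemberSatakeKlein`; LANDING LOG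
  (wave 3): the copies here were deleted; registered anchor `asaiLocalIdentity_anchor` at the end;)
* `residueCard_under_of_smul_ne`, `residueCard_under_sq_of_smul_eq` — `q_{w ∩ M} = q_w` resp.
  `q_{w ∩ M}² = q_w`;
* `under_eq_or_of_four`, `tprod_fibre_eq` — the places of `E'` above `v = w₀ ∩ F₀` are `w₀ ∩ E'` and
  `tw₀ ∩ E'`, and a finite product over them is `g(w₀ ∩ E') g(tw₀ ∩ E')` or `g(w₀ ∩ E')`;
* `inertiaDeg_mul_card_eq_four` — `f(w₀|v) · #{w₀, tw₀, θw₀, θtw₀} = 4` at an unramified `v`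
  (`finsum_inertiaDeg_eq_finrank`);
* `klein_relations` — `t₀² = θ₀² = 1`, `θ₀ t₀ = t₀ θ₀`;
* three preliminaries of the last file of the chain, parked here for size: `exists_ringHom_of_restricts`
  (`F₀ → F' = L^s` inside `L` when `s|_K = cK`, `IsGalois.fixedField_top`),
  `tendsto_nhdsWithin_of_continuation_ball` (boundary limit at `1⁺` of a function holomorphic on
  `{1 < Re s}` with a continuation holomorphic on `{1 < Re s} ∪ B(1, δ)`; a variant of the accepted
  `tendsto_nhdsWithin_one_lt_re_of_continuation`), and `eq_of_hasAsaiPole_of_tendsto` (a typed Asai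
  pole at `θ` and a finite raw limit at `-η` on one Asai datum force `θ = η`).  [folklore]
-/

set_option linter.dupNamespace false -- project-wide option (lakefile weak.linter.dupNamespace); `Summit.Langlands.Langlands` is the mandated namespace

open scoped Classical Topology
open Literature.NumberTheory.Automorphic
open Summit.Langlands.Langlands.Theorems.HostInducedRep.Negative
open IsDedekindDomain NumberField Polynomial Filter

namespace Summit.Langlands.Langlands.Theorems.HostInducedRep.OneTransparentPane

section Fibre

variable {F₀ M L : Type} [Field F₀] [NumberField F₀] [Field M] [NumberField M] [Field L] [NumberField L]
  [Algebra F₀ M] [Algebra M L] [Algebra F₀ L] [IsScalarTower F₀ M L]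

omit [NumberField F₀] [Algebra F₀ M] [Algebra F₀ L] [IsScalarTower F₀ M L] in
/-- The residue cardinality below a place moved by the involution of a quadratic `L/M`:
`q_{w ∩ M} = q_w` (`f = 1`). [folklore] -/
theorem residueCard_under_of_smul_ne (h2 : Module.finrank M L = 2) {a : L ≃ₐ[M] L}
    {w : HeightOneSpectrum (𝓞 L)} (hw : a • w ≠ w) : (w.under (𝓞 M)).residueCard = w.residueCard := by
  rw [residueCard_eq_pow_inertiaDeg (F := M) w, HeightOneSpectrum.inertiaDeg_eq_one_of_smul_ne h2 hw,
    pow_one]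

omit [NumberField F₀] [Algebra F₀ M] [Algebra F₀ L] [IsScalarTower F₀ M L] in
/-- The residue cardinality below a place fixed by the involution of a quadratic `L/M`, unramified:
`q_{w ∩ M}² = q_w` (`f = 2`). [folklore] -/
theorem residueCard_under_sq_of_smul_eq (h2 : Module.finrank M L = 2) {a : L ≃ₐ[M] L} (ha : a ≠ 1)
    {w : HeightOneSpectrum (𝓞 L)} (hw : a • w = w) (hunr : Algebra.IsUnramifiedIn (𝓞 L) (w.under (𝓞 M)).asIdeal) :
    (w.under (𝓞 M)).residueCard ^ 2 = w.residueCard := by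
  rw [residueCard_eq_pow_inertiaDeg (F := M) w, inertiaDeg_eq_two_of_smul_eq_of_isUnramifiedIn h2 ha hw hunr]

end Fibre

section Subextension

variable {F₀ K E' L : Type} [Field F₀] [NumberField F₀] [Field K] [Field E'] [NumberField E']
  [Field L] [NumberField L] [Algebra F₀ K] [Algebra K L] [Algebra F₀ L] [IsScalarTower F₀ K L]
  [Algebra F₀ E'] [Algebra E' L] [IsScalarTower F₀ E' L]

/-- **The places of `E'` above `v`** are `w₀ ∩ E'` and `t w₀ ∩ E'` (the places of `L` above `v` are
`w₀, t w₀, θ w₀, θ t w₀` and `θ` does not move the place of `E'` below). [folklore] -/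
theorem under_eq_or_of_four (h4 : Module.finrank F₀ L = 4) {t : L ≃ₐ[K] L} {θ : L ≃ₐ[E'] L}
    (ht : t.restrictScalars F₀ ≠ 1) (hθ : θ.restrictScalars F₀ ≠ 1)
    (hθt : θ.restrictScalars F₀ ≠ t.restrictScalars F₀) (hθt1 : θ.restrictScalars F₀ * t.restrictScalars F₀ ≠ 1)
    {w₀ : HeightOneSpectrum (𝓞 L)} {v' : HeightOneSpectrum (𝓞 E')}
    (hv' : v'.under (𝓞 F₀) = w₀.under (𝓞 F₀)) :
    v' = w₀.under (𝓞 E') ∨ v' = (t • w₀).under (𝓞 E') := by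
  set w := placeAbove L v' with hw
  have hwv' : w.under (𝓞 E') = v' := placeAbove_under v'
  have hwv : w.under (𝓞 F₀) = w₀.under (𝓞 F₀) := by rw [← under_under_place (F := E') w, hwv', hv']
  rw [← hwv']
  rcases eq_or_of_under_eq_four h4 ht hθ hθt hθt1 hwv with h | h | h | h
  · exact Or.inl (by rw [h])
  · exact Or.inr (by rw [h]; rfl)
  · refine Or.inl ?_
    rw [h, HeightOneSpectrum.restrictScalars_smul, HeightOneSpectrum.under_algEquiv_smul]
  · refine Or.inr ?_
    rw [h, HeightOneSpectrum.restrictScalars_smul, HeightOneSpectrum.under_algEquiv_smul]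
    rfl

/-- The finite product of a function over the places of `E'` above `v` is `g(w₀ ∩ E') · g(tw₀ ∩ E')`,
or `g(w₀ ∩ E')` if the two coincide. [folklore] -/
theorem tprod_fibre_eq (h4 : Module.finrank F₀ L = 4) {t : L ≃ₐ[K] L} {θ : L ≃ₐ[E'] L}
    (ht : t.restrictScalars F₀ ≠ 1) (hθ : θ.restrictScalars F₀ ≠ 1)
    (hθt : θ.restrictScalars F₀ ≠ t.restrictScalars F₀) (hθt1 : θ.restrictScalars F₀ * t.restrictScalars F₀ ≠ 1)
    {w₀ : HeightOneSpectrum (𝓞 L)} {v : HeightOneSpectrum (𝓞 F₀)} (hw₀ : w₀.under (𝓞 F₀) = v)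
    (g : HeightOneSpectrum (𝓞 E') → ℂ) :
    ∏' v' : {v' : HeightOneSpectrum (𝓞 E') // v'.under (𝓞 F₀) = v}, g v'.1 =
      if (t • w₀).under (𝓞 E') = w₀.under (𝓞 E') then g (w₀.under (𝓞 E'))
      else g (w₀.under (𝓞 E')) * g ((t • w₀).under (𝓞 E')) := by
  classical
  haveI := finite_placesOver (E := E') v
  haveI : Fintype {v' : HeightOneSpectrum (𝓞 E') // v'.under (𝓞 F₀) = v} := Fintype.ofFinite _
  have h₁ : (w₀.under (𝓞 E')).under (𝓞 F₀) = v := by rw [under_under_place, hw₀]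
  have h₂ : ((t • w₀).under (𝓞 E')).under (𝓞 F₀) = v := by
    rw [under_under_place, ← HeightOneSpectrum.restrictScalars_smul (F := F₀), HeightOneSpectrum.under_algEquiv_smul, hw₀]
  have huniv : (Finset.univ : Finset {v' : HeightOneSpectrum (𝓞 E') // v'.under (𝓞 F₀) = v}) =
      {⟨w₀.under (𝓞 E'), h₁⟩, ⟨(t • w₀).under (𝓞 E'), h₂⟩} := by
    ext v'
    simp only [Finset.mem_univ, Finset.mem_insert, Finset.mem_singleton, true_iff]
    rcases under_eq_or_of_four h4 ht hθ hθt hθt1 (v'.2.trans hw₀.symm) with h | h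
    · exact Or.inl (Subtype.ext h)
    · exact Or.inr (Subtype.ext h)
  rw [tprod_fintype, huniv]
  split_ifs with heq
  · rw [show (⟨(t • w₀).under (𝓞 E'), h₂⟩ : {v' : HeightOneSpectrum (𝓞 E') // v'.under (𝓞 F₀) = v}) =
        ⟨w₀.under (𝓞 E'), h₁⟩ from Subtype.ext heq, Finset.pair_eq_singleton, Finset.prod_singleton]
  · rw [Finset.prod_pair fun h => heq (congrArg Subtype.val h).symm]

omit [NumberField E'] in
/-- **`f(w₀|v) · #{w₀, tw₀, θw₀, θtw₀} = 4` at an unramified `v`** (the places above `v` form this set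
and have the same residue degree; `∑_{w|v} f(w|v) = [L:F₀]`). [folklore] -/
theorem inertiaDeg_mul_card_eq_four (h4 : Module.finrank F₀ L = 4) {t : L ≃ₐ[K] L} {θ : L ≃ₐ[E'] L}
    (ht : t.restrictScalars F₀ ≠ 1) (hθ : θ.restrictScalars F₀ ≠ 1)
    (hθt : θ.restrictScalars F₀ ≠ t.restrictScalars F₀) (hθt1 : θ.restrictScalars F₀ * t.restrictScalars F₀ ≠ 1)
    {w₀ : HeightOneSpectrum (𝓞 L)} (hv : Algebra.IsUnramifiedIn (𝓞 L) (w₀.under (𝓞 F₀)).asIdeal) :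
    w₀.asIdeal.inertiaDeg (𝓞 F₀) *
      ({w₀, t • w₀, θ • w₀, θ • t • w₀} : Finset (HeightOneSpectrum (𝓞 L))).card = 4 := by
  classical
  have hsum := finsum_inertiaDeg_eq_finrank (E := L) (w₀.under (𝓞 F₀)) hv
  have hset : {w : HeightOneSpectrum (𝓞 L) | w.asIdeal.under (𝓞 F₀) = (w₀.under (𝓞 F₀)).asIdeal} =
      ↑({w₀, t • w₀, θ • w₀, θ • t • w₀} : Finset (HeightOneSpectrum (𝓞 L))) := by
    ext w
    simp only [Set.mem_setOf_eq, Finset.coe_insert, Finset.coe_singleton, Set.mem_insert_iff,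
      Set.mem_singleton_iff]
    constructor
    · intro hw
      exact eq_or_of_under_eq_four h4 ht hθ hθt hθt1 (HeightOneSpectrum.ext hw)
    · rintro (rfl | rfl | rfl | rfl)
      · rfl
      · rw [← HeightOneSpectrum.under_asIdeal, ← HeightOneSpectrum.restrictScalars_smul (F := F₀),
          HeightOneSpectrum.under_algEquiv_smul]
      · rw [← HeightOneSpectrum.under_asIdeal, ← HeightOneSpectrum.restrictScalars_smul (F := F₀),
          HeightOneSpectrum.under_algEquiv_smul]
      · rw [← HeightOneSpectrum.under_asIdeal, ← HeightOneSpectrum.restrictScalars_smul (F := F₀),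
          HeightOneSpectrum.under_algEquiv_smul, ← HeightOneSpectrum.restrictScalars_smul (F := F₀),
          HeightOneSpectrum.under_algEquiv_smul]
  rw [hset, finsum_mem_coe_finset, h4] at hsum
  have hconst : ∀ w ∈ ({w₀, t • w₀, θ • w₀, θ • t • w₀} : Finset (HeightOneSpectrum (𝓞 L))),
      w.asIdeal.inertiaDeg (𝓞 F₀) = w₀.asIdeal.inertiaDeg (𝓞 F₀) := by
    intro w hw
    simp only [Finset.mem_insert, Finset.mem_singleton] at hw
    rcases hw with rfl | rfl | rfl | rfl
    · rfl
    · rw [← HeightOneSpectrum.restrictScalars_smul (F := F₀), HeightOneSpectrum.inertiaDeg_algEquiv_smul]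
    · rw [← HeightOneSpectrum.restrictScalars_smul (F := F₀), HeightOneSpectrum.inertiaDeg_algEquiv_smul]
    · rw [← HeightOneSpectrum.restrictScalars_smul (F := F₀), HeightOneSpectrum.inertiaDeg_algEquiv_smul,
        ← HeightOneSpectrum.restrictScalars_smul (F := F₀), HeightOneSpectrum.inertiaDeg_algEquiv_smul]
  rw [Finset.sum_congr rfl hconst, Finset.sum_const, smul_eq_mul, mul_comm] at hsum
  exact hsum

end Subextension

section Klein

variable {F₀ K E' L : Type} [Field F₀] [Field K] [Field E'] [Field L]
  [Algebra F₀ K] [Algebra K L] [Algebra F₀ L] [IsScalarTower F₀ K L]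
  [Algebra F₀ E'] [Algebra E' L] [IsScalarTower F₀ E' L]

/-- `a.restrictScalars F₀ = 1 ↔ a = 1`. [folklore] -/
theorem restrictScalars_eq_one_iff (a : L ≃ₐ[E'] L) : a.restrictScalars F₀ = 1 ↔ a = 1 := by
  constructor
  · intro h
    exact AlgEquiv.ext fun x => by simpa using AlgEquiv.congr_fun h x
  · rintro rfl
    exact AlgEquiv.ext fun _ => rfl

/-- The relations of the Klein group generated by the two involutions `t₀ = t|^{F₀}` (of `L/K`) and
`θ₀ = θ|^{F₀}` (of `L/E'`): `t₀² = θ₀² = 1` and `θ₀ t₀ = t₀ θ₀`. [folklore] -/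
theorem klein_relations (h4 : Module.finrank F₀ L = 4) (h2K : Module.finrank K L = 2)
    (h2E : Module.finrank E' L = 2) {t : L ≃ₐ[K] L} {θ : L ≃ₐ[E'] L} (ht : t ≠ 1) (hθ : θ ≠ 1)
    (hθt : θ.restrictScalars F₀ ≠ t.restrictScalars F₀)
    (hθt1 : θ.restrictScalars F₀ * t.restrictScalars F₀ ≠ 1) :
    t.restrictScalars F₀ ≠ 1 ∧ θ.restrictScalars F₀ ≠ 1 ∧
      t.restrictScalars F₀ * t.restrictScalars F₀ = 1 ∧ θ.restrictScalars F₀ * θ.restrictScalars F₀ = 1 ∧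
        θ.restrictScalars F₀ * t.restrictScalars F₀ = t.restrictScalars F₀ * θ.restrictScalars F₀ := by
  have ht₀ : t.restrictScalars F₀ ≠ 1 := fun h => ht ((restrictScalars_eq_one_iff t).mp h)
  have hθ₀ : θ.restrictScalars F₀ ≠ 1 := fun h => hθ ((restrictScalars_eq_one_iff θ).mp h)
  have htt : t.restrictScalars F₀ * t.restrictScalars F₀ = 1 := by
    rw [← AlgEquiv.restrictScalars_mul', AlgEquiv.mul_self_eq_one_of_finrank_eq_two h2K t]
    exact AlgEquiv.ext fun _ => rfl
  have hθθ : θ.restrictScalars F₀ * θ.restrictScalars F₀ = 1 := by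
    rw [← AlgEquiv.restrictScalars_mul', AlgEquiv.mul_self_eq_one_of_finrank_eq_two h2E θ]
    exact AlgEquiv.ext fun _ => rfl
  exact ⟨ht₀, hθ₀, htt, hθθ, (mul_comm_of_four h4 ht₀ hθ₀ hθt hθt1 htt).symm⟩

end Klein

/-! ### Preliminaries for the last file of the chain -/

section Prelims

/-- **`F₀ ⊆ F' = L^s` inside `L`**: if `s` restricts to `cK` on `K` then every element of `F₀` is
`s`-fixed, hence lies in the fixed field of `Aut(L/F') = {1, s}`, which is (the image of) `F'`
(`IsGalois.fixedField_top`); this yields a ring map `F₀ → F'` compatible with the maps to `L`.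
[folklore] -/
theorem exists_ringHom_of_restricts {F₀ K F' L : Type} [Field F₀] [Field K] [Field F'] [NumberField F']
    [Field L] [NumberField L] [Algebra F₀ K] [Algebra K L] [Algebra F' L]
    (h2F' : Module.finrank F' L = 2) {s : L ≃ₐ[F'] L} (hs : s ≠ 1)
    {cK : K ≃ₐ[F₀] K} (hsK : ∀ x : K, s (algebraMap K L x) = algebraMap K L (cK x)) :
    ∃ φ : F₀ →+* F', ∀ x : F₀, algebraMap F' L (φ x) = algebraMap K L (algebraMap F₀ K x) := by
  haveI : Algebra.IsQuadraticExtension F' L := { finrank_eq_two' := h2F' }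
  haveI : FiniteDimensional F' L := Module.finite_of_finrank_eq_succ h2F'
  have hmem : ∀ x : F₀, ∃ y : F', algebraMap F' L y = algebraMap K L (algebraMap F₀ K x) := by
    intro x
    have hfix : algebraMap K L (algebraMap F₀ K x) ∈
        IntermediateField.fixedField (⊤ : Subgroup (L ≃ₐ[F'] L)) := by
      rw [IntermediateField.mem_fixedField_iff]
      intro g _
      rcases AlgEquiv.eq_one_or_eq_of_finrank_eq_two h2F' hs g with rfl | rfl
      · rfl
      · rw [hsK, cK.commutes]
    rw [IsGalois.fixedField_top, IntermediateField.mem_bot] at hfix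
    obtain ⟨y, hy⟩ := hfix
    exact ⟨y, hy⟩
  choose φ hφ using hmem
  have hinj := (algebraMap F' L).injective
  refine ⟨⟨⟨⟨φ, hinj ?_⟩, fun x y => hinj ?_⟩, hinj ?_, fun x y => hinj ?_⟩, hφ⟩
  · rw [hφ, map_one, map_one, map_one]
  · simp only [hφ, map_mul]
  · rw [hφ, map_zero, map_zero, map_zero]
  · simp only [hφ, map_add]

/-- **From a holomorphic continuation to the boundary limit.**  If `f` is holomorphic on `{1 < Re s}`,
`G` is holomorphic on `{1 < Re s} ∪ B(1, δ)` and `G = f` on a right half-plane `{σ₀ < Re s}`,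
`σ₀ ≥ 1`, then `f → G(1)` as `s → 1`, `Re s > 1` (identity theorem on the convex `{1 < Re s}`, continuity
of `G` at `1`); a variant of the accepted `tendsto_nhdsWithin_one_lt_re_of_continuation` (there the
continuation lives on `{1/2 < Re s}`). [folklore] -/
theorem tendsto_nhdsWithin_of_continuation_ball {f G : ℂ → ℂ} {σ₀ δ : ℝ} (hσ₀ : 1 ≤ σ₀) (hδ : 0 < δ)
    (hG : DifferentiableOn ℂ G ({s : ℂ | 1 < s.re} ∪ Metric.ball 1 δ))
    (hf : DifferentiableOn ℂ f {s : ℂ | 1 < s.re}) (hfG : ∀ s : ℂ, σ₀ < s.re → G s = f s) :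
    Tendsto f (𝓝[{s : ℂ | 1 < s.re}] 1) (𝓝 (G 1)) := by
  have hV : IsOpen {s : ℂ | 1 < s.re} := isOpen_lt continuous_const Complex.continuous_re
  have hU : IsOpen ({s : ℂ | 1 < s.re} ∪ Metric.ball 1 δ) := hV.union Metric.isOpen_ball
  have hfa : AnalyticOnNhd ℂ f {s : ℂ | 1 < s.re} := hf.analyticOnNhd hV
  have hGa : AnalyticOnNhd ℂ G {s : ℂ | 1 < s.re} := (hG.mono Set.subset_union_left).analyticOnNhd hV
  set z₀ : ℂ := ((σ₀ + 1 : ℝ) : ℂ) with hz₀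
  have hz₀re : z₀.re = σ₀ + 1 := by simp [hz₀]
  have hz₀V : z₀ ∈ {s : ℂ | 1 < s.re} := by
    simp only [Set.mem_setOf_eq, hz₀re]; linarith
  have hev : f =ᶠ[𝓝 z₀] G := by
    have hmem : {s : ℂ | σ₀ < s.re} ∈ 𝓝 z₀ :=
      (isOpen_lt continuous_const Complex.continuous_re).mem_nhds (by
        simp only [Set.mem_setOf_eq, hz₀re]; linarith)
    exact Filter.eventually_of_mem hmem fun s hs => (hfG s hs).symm
  have heq : Set.EqOn f G {s : ℂ | 1 < s.re} :=
    hfa.eqOn_of_preconnected_of_eventuallyEq hGa (convex_halfSpace_re_gt 1).isPreconnected hz₀V hev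
  have h1U : (1 : ℂ) ∈ {s : ℂ | 1 < s.re} ∪ Metric.ball 1 δ := Or.inr (Metric.mem_ball_self hδ)
  have hGc : ContinuousAt G 1 := (hG.differentiableAt (hU.mem_nhds h1U)).continuousAt
  exact (hGc.tendsto.mono_left nhdsWithin_le_nhds).congr'
    (eventually_nhdsWithin_of_forall fun s hs => (heq hs).symm)

/-- **A typed Asai pole at `θ` and a finite raw limit at `-η` on one Asai datum force `θ = η`**:
otherwise `θ = -η` and the raw product `L^S(s, π, As^{-η})` would have both a genuine simple pole and a
finite limit at `1⁺` (`not_tendsto_of_tendsto_sub_one_mul`).  This is the uniqueness half of Mok's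
dichotomy in the typed currency, datum by datum. [folklore] -/
theorem eq_of_hasAsaiPole_of_tendsto {F E : Type} [Field F] [NumberField F] [Field E] [NumberField E]
    [Algebra F E] {N : ℕ} {hcpt : isCompact_glFiniteIntegralLevel N E}
    {π : AutomorphicRepData (AutomorphyDatum.gl N E hcpt)} {c : E ≃ₐ[F] E}
    {S : Set (HeightOneSpectrum (𝓞 F))} {A : SatakeFamily E} (hSA : π.IsAsaiDatum c S A) {θ η : ℤˣ}
    (hθ : π.HasAsaiPole c θ)
    (hfin : ∃ r : ℂ, Tendsto (partialAsaiL S c A (-η)) (𝓝[{s : ℂ | 1 < s.re}] 1) (𝓝 r)) : θ = η := by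
  by_contra hne
  obtain ⟨r, hr, hlim⟩ := hθ hSA
  obtain ⟨d, hd⟩ := hfin
  rw [Int.units_ne_iff_eq_neg.mp hne] at hlim
  exact not_tendsto_of_tendsto_sub_one_mul hr hlim d hd

end Prelims

/-- **Registered anchor** of this helper file (stub registry of stmt-Langlands-10902, line
`one-transparent-pane`, chain `stub_asaiPoleInduced` 3/7): `a.restrictScalars F₀ = 1 ↔ a = 1`,
`restrictScalars_eq_one_iff`. [folklore] -/
theorem asaiLocalIdentity_anchor : ∀ (F₀ E' L : Type) [Field F₀] [Field E'] [Field L] [Algebra F₀ E'] [Algebra E' L] [Algebra F₀ L] [IsScalarTower F₀ E' L] (a : L ≃ₐ[E'] L), AlgEquiv.restrictScalars F₀ a = 1 ↔ a = 1 :=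
  fun _ _ _ _ _ _ _ _ _ _ a => restrictScalars_eq_one_iff a

end Summit.Langlands.Langlands.Theorems.HostInducedRep.OneTransparentPane
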